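/- Copyright: ym3-torus cell, WIDTH-5 ATTACH seat `ym-ust-19936-w4` (prover, g11), for crux `HistoryTailL` (stmt-QuantumFields-19936),
line «local_insertion»: the registered FIRST RUNG `stub_insertionHeightOne` — PROVED, by the elementary road over the level-0 lane.
Released under the licence of the surrounding project. -/
import Summits.QuantumFields.YangMills.Theorems.LocalInsertionBoundedHeightTailUniform
import Summits.QuantumFields.YangMills.Theorems.LocalInsertionMomentOfWindowTail
import Summits.QuantumFields.YangMills.Theorems.LocalInsertionHistoryTailOfInsertionL
import HarnessLib

/-!
# Line «local_insertion» on crux `HistoryTailL` (stmt-QuantumFields-19936) — THE REGISTERED STUB `stub_insertionHeightOne` IS A THEOREM: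
# the fixed-ε local exponential moment of the once-averaged plaquette at HEIGHT ONE, for EVERY cut-off `K ≥ 1`, unconditionally

Cell `ym3-torus` (YM ladder rung R3 = continuum SU(2) Yang–Mills on the three-torus — a RUNG, NOT the Clay problem: not d = 4, not
infinite volume, not a mass gap), width seat `ym-ust-19936-w4` gen 11, `--supports stmt-QuantumFields-19936 --as helper`.  THEOREMS ONLY,
definition-free.  (By-name layer: this file imports ★w3 g11's door module `LocalInsertionMomentOfWindowTail`, which sits in the `Theses.LocalInsertion`
cone; the route-independent input — the prefactor-free bounded-height tail — lives in `LocalInsertionBoundedHeightTailUniform`.)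

WHAT.  ✓`BoundedHeightTailUniform.gibbsK_real_window_ge_le_uniform` (crude transport × the level-0 UNIFORM tail of the T1–T4 lane) is a GAUSSIAN
window tail `Gibbs_K{t·g_{K−j} ≤ |Ū^{j}(∂a) − 1|} ≤ (81L³)^j e^{A}·exp(−t²·L^j∕(8·((151L²)^j)²))` with `(L, j)`-constants.  At HEIGHT ONE this is all the
registered stub wants: ★w3 g11's door ✓`MomentOfWindowTail.insertionHeightOne_of_windowExpTail` turns a linear-exponential window tail at `j ≤ 1`
into the stub's signature VERBATIM, and a Gaussian tail is linear-exponential with any rate (§1 `windowExpTail_heightOne`: `κ := 1`,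
`C := 81L³e^{A}·e^{1∕(4c₁)}`, `c₁ = L∕(8·(151L²)²)`, `γ₁ := 1∕8`; the good set `G(a,1)` is simply dropped).  Hence

  §2 ★★★`stub_insertionHeightOne` — THE REGISTERED FIRST RUNG OF `Cruxes/HistoryTailL/Lines/local_insertion.lean` (48f0ac19), EXACT TEXT, NO
  HYPOTHESIS: every `L`, `ε ≤ ε₀ := ½`, every profile `b₀ > 0`, `p₀ > 2`, EVERY cut-off `K ≥ j = 1` (not only the interior `K ≥ 3`), NO K1
  (`MesoscopicConcentrationL`), NO K2, NO median row — the K1 road ✓`InsertionHeightOneOfMeanPlaquette` ∕ ✓`GoodHeightOne` ∕ ✓`HeightOneOfConcentration`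
  (interior `K ≥ 3`, conditional on K1) is superseded for this stub;

  §3 ★`insertionIntegral_boundedHeight_le` — the same integrand bound for EVERY `ε ≥ 0` at every BOUNDED height `1 ≤ j ≤ j₀`, constants `(L, j₀, ε)`
  (✓`insertionIntegral_le_of_gaussTail`, `t₀ := 0`);

  §4 BY NAME: ★★`localInsertionL_of_insertionHigher (h2 : ⟨stub_insertionHigher VERBATIM⟩) : LocalInsertionL` (the registered composition with its
  first argument discharged) and ★★`historyTailL_of_insertionHigher (h2) : UnitScaleTilt.HistoryTailL` (∘ the landed glue ✓`historyTailOfInsertionL_proof`,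
  stmt-23608) — line «local_insertion» now reads `HistoryTailL ⟸ stub_insertionHigher` ALONE, by kernel.

WHY THIS DOES NOT TOUCH THE ORGAN.  `stub_insertionHigher` asks ONE `M₀` for all `2 ≤ j ≤ K`; here the constants grow like `(81L³)^{j₀}`,
`(151L²)^{2j₀}` — the `j`-UNIFORM statement («averaging is smoothing»; LEAD census v1.19 (c)) is exactly what is NOT proved, and remains the
content of `LocalInsertionL` (stmt-23607).

HONEST FRAMING.  Elementary over tree theorems.  Proves ONE registered stub (the first rung of a DRAFT sibling line whose registry slot has since
moved; the theorem carries the stub's exact text and name).  Nothing of `stub_insertionHigher`, `LocalInsertionL`, the crux `HistoryTailL`, K1,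
NODE O, d = 4, a continuum limit or a mass gap is proved.  YM₃ on T³ is rung R3, NOT the Clay problem.

References: T. Bałaban, CMP **98** (1985) 17–51 [Balaban1985Averaging] (Prop. 1 (51) p.26); CMP **102** (1985) 255–275 [Balaban1985UV3]
((3) p.256, (7) p.257, (71) p.273).
-/

set_option autoImplicit false

noncomputable section

open scoped BigOperators
open MeasureTheory
open Literature.MathematicalPhysics.QuantumFieldTheory
open Literature.MathematicalPhysics.QuantumFieldTheory.Balaban1983to89
open Literature.MathematicalPhysics.QuantumFieldTheory.Balaban1983to89.T3ContinuumYM3Torus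
open Literature.MathematicalPhysics.QuantumFieldTheory.Balaban1983to89.T3UnitScaleTilt
open Literature.MathematicalPhysics.QuantumFieldTheory.Balaban1983to89.T3UnitLawDensityEML
open Summit.QuantumFields.YangMills.Theorems.LocalInsertion.BoundedHeightTailUniform (gibbsK_real_window_ge_le_uniform gauss_le_linExp)
open Summit.QuantumFields.YangMills.Theorems.LocalInsertion.MomentOfWindowTail
  (insertionHeightOne_of_windowExpTail insertionIntegral_le_of_gaussTail measurableSet_window)

namespace Summit.QuantumFields.YangMills.Theorems.LocalInsertion.StubHeightOne

/-! ## §1 The linear-exponential window tail at height one, in the door's letters -/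

/-- **THE WINDOW TAIL AT HEIGHT ONE, IN THE LETTERS OF ✓`insertionHeightOne_of_windowExpTail`** (`κ := 1`; drop the good set `G(a,j)` by
monotonicity; at `j = 1`: `C := 81L³·e^{A}·e^{1∕(4c₁)}`, `c₁ = L∕(8·(151L²)²)`, `γ₁ := 1∕8`).  UNCONDITIONAL.
[cite: Balaban1985Averaging, Prop. 1 (51) p.26; Balaban1985UV3, (7) p.257 and (71) p.273] -/
theorem windowExpTail_heightOne :
    ∀ (L : ℕ), ∃ κ : ℝ, 0 < κ ∧ ∀ (b₀ p₀ : ℝ), 0 < b₀ → 2 < p₀ → ∃ C : ℝ, 0 ≤ C ∧ ∃ γ₁ : ℝ, 0 < γ₁ ∧ γ₁ ≤ 1 ∧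
      ∀ (F : T3Family) (γ : ℝ), F.L = L → 0 < γ → γ ≤ γ₁ → ∀ (K j : ℕ), 1 ≤ j → j ≤ K → j ≤ 1 →
        ∀ (a : Plaq (F.P K) j) (n : ℕ),
          (gibbsK F ℰp γ K).real ({U : GaugeField (F.P K) 0 (Matrix.specialUnitaryGroup (Fin 2) ℂ) |
              (∀ (i : ℕ) (q : Plaq (F.P K) i), i < j →
                Site.tdist (fun k => ((((q.src k).val * F.L ^ i : ℕ)) : ZMod ((F.P K).sitesPerDir 0)))
                    (fun k => ((((a.src k).val * F.L ^ j : ℕ)) : ZMod ((F.P K).sitesPerDir 0))) + 64 * F.L ^ i ≤ 64 * F.L ^ j →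
                GaugeGroup.dist1 (GaugeField.plaqHol
                  (Averaging.iter (fun i' => BlockAveraging.blockAvg (P := F.P K) (j := i') ℰp) i U) q) <
                  θBal F.L γ b₀ p₀ (K - i))} ∩
            {U | (n : ℝ) * Real.sqrt (γ * ((F.L : ℝ)⁻¹) ^ (K - j)) ≤
              GaugeGroup.dist1 (GaugeField.plaqHol
                (Averaging.iter (fun i' => BlockAveraging.blockAvg (P := F.P K) (j := i') ℰp) j U) a)}) ≤
            C * Real.exp (-(κ * n)) := by
  intro L
  obtain ⟨A, hA⟩ := gibbsK_real_window_ge_le_uniform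
  refine ⟨1, one_pos, fun b₀ p₀ _ _ => ?_⟩
  -- the constants at `j = 1` (an empty family if `L = 0`; the constants are then irrelevant)
  set c₁ : ℝ := (L : ℝ) ^ 1 / (8 * ((151 * (L : ℝ) ^ 2) ^ 1) ^ 2) with hc₁
  by_cases hL : 1 ≤ L
  swap
  · refine ⟨0, le_rfl, 1 / 8, by norm_num, by norm_num, fun F γ hFL => absurd (hFL ▸ F.hL.2.le) hL⟩
  have hLr : (1 : ℝ) ≤ L := by exact_mod_cast hL
  have hc₁0 : 0 < c₁ := by positivity
  refine ⟨(81 * (L : ℝ) ^ 3) ^ 1 * Real.exp A * Real.exp (1 / (4 * c₁)), by positivity, 1 / 8, by norm_num, by norm_num,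
    fun F γ hFL hγ hγle K j hj hjK hj1 a n => ?_⟩
  obtain rfl : j = 1 := le_antisymm hj1 hj
  subst hFL
  haveI := isProbabilityMeasure_gibbsK F ℰp hγ.le K
  refine (measureReal_mono Set.inter_subset_right (measure_ne_top _ _)).trans ?_
  have h := hA F γ hγ hγle K 1 hjK (n : ℝ) (Nat.cast_nonneg n) a
  refine h.trans ?_
  have hg := gauss_le_linExp (C := (81 * (F.L : ℝ) ^ 3) ^ 1 * Real.exp A) (by positivity) hc₁0 (n : ℝ)
  have hexp : -((n : ℝ) ^ 2 * (F.L : ℝ) ^ 1 / (8 * ((151 * (F.L : ℝ) ^ 2) ^ 1) ^ 2)) = -(c₁ * (n : ℝ) ^ 2) := by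
    rw [hc₁]; ring
  rw [hexp]
  exact hg

/-! ## §2 The registered stub -/

/-- ★★★ **`stub_insertionHeightOne` — THE REGISTERED FIRST RUNG OF LINE «local_insertion» (`Cruxes/HistoryTailL/Lines/local_insertion.lean`,
48f0ac19), EXACT TEXT, PROVED WITHOUT HYPOTHESES.**  For every `L` there is `ε₀ > 0` (`:= ½`) such that for all `0 < ε ≤ ε₀` and every profile
`b₀ > 0`, `p₀ > 2` there are `M₀ ≥ 0` and `γ₁ ∈ (0, 1]` (`:= 1∕8`) with: for every family `F` (`F.L = L`), every `0 < γ ≤ γ₁`, EVERY cut-off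
`K ≥ 1` (`j = 1 ≤ K`) and every plaquette `a` of `T^{(1)}`,
`∫_{G(a,1)} exp(ε·min(dist1(Ū¹(∂a))∕g_{K−1}, p(g_{K−1}))) ∂Gibbs_K ≤ M₀`.  ★w3 g11's door ✓`insertionHeightOne_of_windowExpTail` fed with §1.
The organ-adjacent companion `stub_insertionHigher` (one `M₀` for ALL `2 ≤ j ≤ K`) is NOT proved; nothing of `LocalInsertionL`, K1, the crux
`HistoryTailL`, d = 4 or a mass gap is proved. [cite: Balaban1985UV3, (7) p.257 and (71) p.273; Balaban1985Averaging, Prop. 1 (51) p.26] -/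
theorem stub_insertionHeightOne :
    open Literature.MathematicalPhysics.QuantumFieldTheory.Balaban1983to89 Literature.MathematicalPhysics.QuantumFieldTheory.Balaban1983to89.T3ContinuumYM3Torus in ∀ (L : ℕ), ∃ ε₀ : ℝ, 0 < ε₀ ∧ ∀ (ε : ℝ), 0 < ε → ε ≤ ε₀ → ∀ (b₀ p₀ : ℝ), 0 < b₀ → 2 < p₀ → ∃ M₀ : ℝ, 0 ≤ M₀ ∧ ∃ γ₁ : ℝ, 0 < γ₁ ∧ γ₁ ≤ 1 ∧ ∀ (F : T3Family) (γ : ℝ), F.L = L → 0 < γ → γ ≤ γ₁ → ∀ (K j : ℕ), 1 ≤ j → j ≤ K → j ≤ 1 → ∀ (a : Plaq (F.P K) j), ∫ U in {U | (∀ (i : ℕ) (q : Plaq (F.P K) i), i < j → Site.tdist (fun k => ((((q.src k).val * F.L ^ i : ℕ)) : ZMod ((F.P K).sitesPerDir 0))) (fun k => ((((a.src k).val * F.L ^ j : ℕ)) : ZMod ((F.P K).sitesPerDir 0))) + 64 * F.L ^ i ≤ 64 * F.L ^ j → GaugeGroup.dist1 (GaugeField.plaqHol (Averaging.iter (fun i'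 => BlockAveraging.blockAvg (P := F.P K) (j := i') T3UnitLawDensityEML.ℰp) i U) q) < T3UnitScaleTilt.θBal F.L γ b₀ p₀ (K - i))}, Real.exp (ε * min (GaugeGroup.dist1 (GaugeField.plaqHol (Averaging.iter (fun i' => BlockAveraging.blockAvg (P := F.P K) (j := i') T3UnitLawDensityEML.ℰp) j U) a) / Real.sqrt (γ * ((F.L : ℝ)⁻¹) ^ (K - j))) (B10.pFun b₀ p₀ (Real.sqrt (γ * ((F.L : ℝ)⁻¹) ^ (K - j))))) ∂(T3UnitScaleTilt.gibbsK F T3UnitLawDensityEML.ℰp γ K) ≤ M₀ :=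
  insertionHeightOne_of_windowExpTail windowExpTail_heightOne

/-! ## §3 Every `ε`, every bounded height: the integrand bound with `(L, j₀, ε)`-constants -/

/-- **THE LOCAL EXPONENTIAL MOMENT AT BOUNDED HEIGHT, FOR EVERY `ε ≥ 0`.**  For every `L`, `j₀` and `ε ≥ 0` there is `M₀ ≥ 0` such that for every
family `F` (`F.L = L`), every `0 < γ ≤ 1∕8`, every profile `(b₀, p₀)`, every `1 ≤ j ≤ min(K, j₀)` and every `a ∈ Plaq(T^{(j)})`:
`∫_{G(a,j)} exp(ε·min(dist1(Ū^j(∂a))∕g_{K−j}, p(g_{K−j}))) ∂Gibbs_K ≤ M₀` — the Gaussian window tail ✓`gibbsK_real_window_ge_le_uniform` (rate `c(L, j₀) = L∕(8·(151L²)^{2j₀})` serves all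
`j ≤ j₀`) through ★w3's ✓`insertionIntegral_le_of_gaussTail` (`t₀ := 0`).  The constants grow with `j₀`: this is NOT `stub_insertionHigher`
(one `M₀` for all heights) and says nothing about the organ. [cite: Balaban1985UV3, (7) p.257 and (71) p.273] -/
theorem insertionIntegral_boundedHeight_le :
    ∀ (L j₀ : ℕ) (ε : ℝ), 0 ≤ ε → ∃ M₀ : ℝ, 0 ≤ M₀ ∧ ∀ (F : T3Family) (γ : ℝ), F.L = L → 0 < γ → γ ≤ 1 / 8 →
      ∀ (b₀ p₀ : ℝ) (K j : ℕ), 1 ≤ j → j ≤ K → j ≤ j₀ → ∀ (a : Plaq (F.P K) j),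
        ∫ U in {U : GaugeField (F.P K) 0 (Matrix.specialUnitaryGroup (Fin 2) ℂ) |
            (∀ (i : ℕ) (q : Plaq (F.P K) i), i < j →
              Site.tdist (fun k => ((((q.src k).val * F.L ^ i : ℕ)) : ZMod ((F.P K).sitesPerDir 0)))
                  (fun k => ((((a.src k).val * F.L ^ j : ℕ)) : ZMod ((F.P K).sitesPerDir 0))) + 64 * F.L ^ i ≤ 64 * F.L ^ j →
              GaugeGroup.dist1 (GaugeField.plaqHol
                (Averaging.iter (fun i' => BlockAveraging.blockAvg (P := F.P K) (j := i') ℰp) i U) q) <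
                θBal F.L γ b₀ p₀ (K - i))},
          Real.exp (ε * min (GaugeGroup.dist1 (GaugeField.plaqHol
              (Averaging.iter (fun i' => BlockAveraging.blockAvg (P := F.P K) (j := i') ℰp) j U) a) /
                Real.sqrt (γ * ((F.L : ℝ)⁻¹) ^ (K - j)))
            (B10.pFun b₀ p₀ (Real.sqrt (γ * ((F.L : ℝ)⁻¹) ^ (K - j))))) ∂(gibbsK F ℰp γ K) ≤ M₀ := by
  intro L j₀ ε hε
  obtain ⟨A, hA⟩ := gibbsK_real_window_ge_le_uniform
  by_cases hL : 1 ≤ L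
  swap
  · exact ⟨0, le_rfl, fun F γ hFL => absurd (hFL ▸ F.hL.2.le) hL⟩
  have hLr : (1 : ℝ) ≤ L := by exact_mod_cast hL
  -- uniform constants on the slab `j ≤ j₀`
  set C : ℝ := (81 * (L : ℝ) ^ 3) ^ j₀ * Real.exp A with hC
  set c : ℝ := (L : ℝ) / (8 * ((151 * (L : ℝ) ^ 2) ^ j₀) ^ 2) with hc
  have hC0 : 0 ≤ C := by positivity
  have hc0 : 0 < c := by positivity
  refine ⟨(0 + 1) * Real.exp (ε * (0 + 1)) + 2 * C * Real.exp (ε + (ε + 1) ^ 2 / (4 * c)), by positivity,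
    fun F γ hFL hγ hγ8 b₀ p₀ K j hj hjK hj0 a => ?_⟩
  refine insertionIntegral_le_of_gaussTail F hγ hε hc0 hC0 le_rfl b₀ p₀ a (measurableSet_window F γ b₀ p₀ K j a) fun n _ => ?_
  haveI := isProbabilityMeasure_gibbsK F ℰp hγ.le K
  refine (measureReal_mono Set.inter_subset_right (measure_ne_top _ _)).trans ?_
  refine (hA F γ hγ hγ8 K j hjK (n : ℝ) (Nat.cast_nonneg n) a).trans ?_
  rw [hFL]
  -- compare the `j`-constants with the `j₀`-constants
  have h81 : (1 : ℝ) ≤ 81 * (L : ℝ) ^ 3 := by nlinarith [one_le_pow₀ (n := 3) hLr]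
  have hΛ1 : (1 : ℝ) ≤ 151 * (L : ℝ) ^ 2 := by nlinarith [one_le_pow₀ (n := 2) hLr]
  have hCj : (81 * (L : ℝ) ^ 3) ^ j * Real.exp A ≤ C := by
    rw [hC]; exact mul_le_mul_of_nonneg_right (pow_le_pow_right₀ h81 hj0) (Real.exp_pos A).le
  have hcj : c * (n : ℝ) ^ 2 ≤ (n : ℝ) ^ 2 * (L : ℝ) ^ j / (8 * ((151 * (L : ℝ) ^ 2) ^ j) ^ 2) := by
    have hΛj0 : (0 : ℝ) < ((151 * (L : ℝ) ^ 2) ^ j) ^ 2 := by positivity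
    have hΛmono : ((151 * (L : ℝ) ^ 2) ^ j) ^ 2 ≤ ((151 * (L : ℝ) ^ 2) ^ j₀) ^ 2 :=
      pow_le_pow_left₀ (by positivity) (pow_le_pow_right₀ hΛ1 hj0) 2
    have hLj : (L : ℝ) ≤ (L : ℝ) ^ j := by
      calc (L : ℝ) = (L : ℝ) ^ 1 := (pow_one _).symm
        _ ≤ (L : ℝ) ^ j := pow_le_pow_right₀ hLr hj
    rw [hc, div_mul_eq_mul_div, le_div_iff₀ (by positivity), div_mul_eq_mul_div, div_le_iff₀ (by positivity)]
    have hn2 : (0 : ℝ) ≤ (n : ℝ) ^ 2 := by positivity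
    calc (L : ℝ) * (n : ℝ) ^ 2 * (8 * ((151 * (L : ℝ) ^ 2) ^ j) ^ 2)
        ≤ (L : ℝ) ^ j * (n : ℝ) ^ 2 * (8 * ((151 * (L : ℝ) ^ 2) ^ j₀) ^ 2) := by gcongr
      _ = (n : ℝ) ^ 2 * (L : ℝ) ^ j * (8 * ((151 * (L : ℝ) ^ 2) ^ j₀) ^ 2) := by ring
  have hexp : Real.exp (-((n : ℝ) ^ 2 * (L : ℝ) ^ j / (8 * ((151 * (L : ℝ) ^ 2) ^ j) ^ 2))) ≤ Real.exp (-(c * (n : ℝ) ^ 2)) :=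
    Real.exp_le_exp.mpr (by linarith)
  calc (81 * (L : ℝ) ^ 3) ^ j * Real.exp A * Real.exp (-((n : ℝ) ^ 2 * (L : ℝ) ^ j / (8 * ((151 * (L : ℝ) ^ 2) ^ j) ^ 2)))
      ≤ C * Real.exp (-(c * (n : ℝ) ^ 2)) := mul_le_mul hCj hexp (Real.exp_pos _).le hC0


/-! ## §4 By name: the route crux and the target crux now rest on `stub_insertionHigher` alone -/

/-- **`LocalInsertionL` (stmt-QuantumFields-23607) ⟸ `stub_insertionHigher` ALONE.**  The registered composition `LocalInsertionL_of` of
`Cruxes/HistoryTailL/Lines/local_insertion.lean` (common `ε = min`, constants `max ∕ min`; its proof re-typed here, the Cruxes module not being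
importable) with its first argument DISCHARGED by ★★★`stub_insertionHeightOne`.  CONDITIONAL on the organ-adjacent stub text `h2` (heights
`j ≥ 2`, ONE `M₀` for all of them) — NOT proved anywhere. [cite: Balaban1985UV3, (7) p.257 and (71) p.273] -/
theorem localInsertionL_of_insertionHigher
    (h2 : open Literature.MathematicalPhysics.QuantumFieldTheory.Balaban1983to89 Literature.MathematicalPhysics.QuantumFieldTheory.Balaban1983to89.T3ContinuumYM3Torus in ∀ (L : ℕ), ∃ ε₀ : ℝ, 0 < ε₀ ∧ ∀ (ε : ℝ), 0 < ε → ε ≤ ε₀ → ∀ (b₀ p₀ : ℝ), 0 < b₀ → 2 < p₀ → ∃ M₀ : ℝ, 0 ≤ M₀ ∧ ∃ γ₁ : ℝ, 0 < γ₁ ∧ γ₁ ≤ 1 ∧ ∀ (F : T3Family) (γ : ℝ), F.L = L → 0 < γ → γ ≤ γ₁ → ∀ (K j : ℕ), 1 ≤ j → j ≤ K → 2 ≤ j → ∀ (a : Plaq (F.P K) j), ∫ U in {U | (∀ (i : ℕ) (q : Plaq (F.P K) i), i < j → Site.tdist (fun k => ((((q.src k).val * F.L ^ i : ℕ)) : ZMod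 ((F.P K).sitesPerDir 0))) (fun k => ((((a.src k).val * F.L ^ j : ℕ)) : ZMod ((F.P K).sitesPerDir 0))) + 64 * F.L ^ i ≤ 64 * F.L ^ j → GaugeGroup.dist1 (GaugeField.plaqHol (Averaging.iter (fun i' => BlockAveraging.blockAvg (P := F.P K) (j := i') T3UnitLawDensityEML.ℰp) i U) q) < T3UnitScaleTilt.θBal F.L γ b₀ p₀ (K - i))}, Real.exp (ε * min (GaugeGroup.dist1 (GaugeField.plaqHol (Averaging.iter (fun i' => BlockAveraging.blockAvg (P := F.P K) (j := i') T3UnitLawDensityEML.ℰp) j U) a) / Real.sqrt (γ * ((F.L : ℝ)⁻¹) ^ (K - j))) (B10.pFun b₀ p₀ (Real.sqrt (γ * ((F.L : ℝ)⁻¹) ^ (K - j))))) ∂(T3UnitScaleTilt.gibbsK F T3UnitLawDensityEML.ℰp γ K) ≤ M₀) :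
    Summit.QuantumFields.YangMills.Theses.LocalInsertion.LocalInsertionL := by
  intro L
  obtain ⟨ε₁, hε₁, h1'⟩ := stub_insertionHeightOne L
  obtain ⟨ε₂, hε₂, h2'⟩ := h2 L
  refine ⟨min ε₁ ε₂, lt_min hε₁ hε₂, ?_⟩
  intro b₀ p₀ hb hp
  obtain ⟨M₁, hM₁, γ₁, hγ₁, hγ₁1, H1⟩ := h1' (min ε₁ ε₂) (lt_min hε₁ hε₂) (min_le_left _ _) b₀ p₀ hb hp
  obtain ⟨M₂, hM₂, γ₂, hγ₂, hγ₂1, H2⟩ := h2' (min ε₁ ε₂) (lt_min hε₁ hε₂) (min_le_right _ _) b₀ p₀ hb hp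
  refine ⟨max M₁ M₂, le_max_of_le_left hM₁, min γ₁ γ₂, lt_min hγ₁ hγ₂, (min_le_left _ _).trans hγ₁1, ?_⟩
  intro F γ hFL hγ hγle K j hj hjK a
  by_cases hj1 : j ≤ 1
  · exact (H1 F γ hFL hγ (hγle.trans (min_le_left _ _)) K j hj hjK hj1 a).trans (le_max_left _ _)
  · exact (H2 F γ hFL hγ (hγle.trans (min_le_right _ _)) K j hj hjK (by omega) a).trans (le_max_right _ _)

/-- **`HistoryTailL` (stmt-QuantumFields-19936) ⟸ `stub_insertionHigher` ALONE, through line «local_insertion».**  §4's `LocalInsertionL` fed to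
the landed glue ✓`HistoryTailOfInsertion.historyTailOfInsertionL_proof` (stmt-23608, cross-cell ym-line-sfw-p2).  CONDITIONAL on the organ-adjacent
stub text; nothing of it, of `HistoryTailL` unconditionally, of d = 4 or a mass gap is proved; rung R3, NOT Clay. [cite: Balaban1985UV3, (71) p.273] -/
theorem historyTailL_of_insertionHigher
    (h2 : open Literature.MathematicalPhysics.QuantumFieldTheory.Balaban1983to89 Literature.MathematicalPhysics.QuantumFieldTheory.Balaban1983to89.T3ContinuumYM3Torus in ∀ (L : ℕ), ∃ ε₀ : ℝ, 0 < ε₀ ∧ ∀ (ε : ℝ), 0 < ε → ε ≤ ε₀ → ∀ (b₀ p₀ : ℝ), 0 < b₀ → 2 < p₀ → ∃ M₀ : ℝ, 0 ≤ M₀ ∧ ∃ γ₁ : ℝ, 0 < γ₁ ∧ γ₁ ≤ 1 ∧ ∀ (F : T3Family) (γ : ℝ), F.L = L → 0 < γ → γ ≤ γ₁ → ∀ (K j : ℕ), 1 ≤ j → j ≤ K → 2 ≤ j → ∀ (a : Plaq (F.P K) j), ∫ U in {U | (∀ (i : ℕ) (q : Plaq (F.P K) i), i < j → Site.tdist (fun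 k => ((((q.src k).val * F.L ^ i : ℕ)) : ZMod ((F.P K).sitesPerDir 0))) (fun k => ((((a.src k).val * F.L ^ j : ℕ)) : ZMod ((F.P K).sitesPerDir 0))) + 64 * F.L ^ i ≤ 64 * F.L ^ j → GaugeGroup.dist1 (GaugeField.plaqHol (Averaging.iter (fun i' => BlockAveraging.blockAvg (P := F.P K) (j := i') T3UnitLawDensityEML.ℰp) i U) q) < T3UnitScaleTilt.θBal F.L γ b₀ p₀ (K - i))}, Real.exp (ε * min (GaugeGroup.dist1 (GaugeField.plaqHol (Averaging.iter (fun i' => BlockAveraging.blockAvg (P := F.P K) (j := i') T3UnitLawDensityEML.ℰp) j U) a) / Real.sqrt (γ * ((F.L : ℝ)⁻¹) ^ (K - j))) (B10.pFun b₀ p₀ (Real.sqrt (γ * ((F.L : ℝ)⁻¹) ^ (K - j))))) ∂(T3UnitScaleTilt.gibbsK F T3UnitLawDensityEML.ℰp γ K) ≤ M₀) :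
    Summit.QuantumFields.YangMills.Theses.UnitScaleTilt.HistoryTailL :=
  Summit.QuantumFields.YangMills.Theorems.LocalInsertion.HistoryTailOfInsertion.historyTailOfInsertionL_proof
    (localInsertionL_of_insertionHigher h2)

end Summit.QuantumFields.YangMills.Theorems.LocalInsertion.StubHeightOne

end
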